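import Literature.Topology.FourManifolds.KhBigonStates
import Literature.Topology.FourManifolds.KhGaussElim
import Literature.Topology.FourManifolds.KhComplexDSquaredProofs
import HarnessLib

/-!
# Invariance of Khovanov homology under the second Reidemeister move (the bigon)

Sibling file of `KhComplex.lean`, assembling `KhBigon`, `KhBigonD`, `KhBigonStates` (the bigon
`G.bigon m tf ε` of `PolyakMove.omega2a` in normal position and its adapted basis
`A ⊕ P ⊕ Q ⊕ U ⊕ C(D)`) with the Gaussian elimination of `KhGaussElim` into the second-move case
of the named fact
`Literature.Topology.FourManifolds.GaussDiagram.nonempty_iso_khovanovHomology_of_equiv`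
(Khovanov (2000), Thm. 1, §5.3; Bar-Natan (2002), §4.3):

* `bigonMHtpy` — **the complex of the bigon retracts by deformation onto the complex of `G`**:
  in the adapted basis, rescaled by the Koszul signs, the block `A → P` (split off the small
  circle labelled `X`) and then the block `Q → U` (merge the small circle labelled `1`) are
  identity matrices and are cancelled by two Gaussian eliminations (`KhElim.elim`); what is left
  is the oriented resolution `C(D_{01}) = C(D)` with its own differential (`incidence_bigonD`).
  This needs `d² = 0` for the bigon, which holds as soon as every edge of its cube is a merge or
  a split (`sum_incidence_mul_incidence_eq_zero`), in particular when the bigon is the diagram of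
  a knot (`isMergeAt_or_isSplitAt_of_hasGaussDiagram_holds`);
* `nonempty_iso_khovanovHomology_bigon` — **`Kh^{i,j}(G) ≅ Kh^{i,j}(G.bigon m tf ε)`**, and
  `nonempty_iso_frobeniusHomology_bigon` — the same over the universal Frobenius system, every
  `(R, h, t)`, under that merge-or-split hypothesis; `…_of_hasGaussDiagram` — the same for a
  bigon realised by a knot.

No named fact is introduced; the merge-or-split hypothesis is the conclusion of the *proved*
fact `isMergeAt_or_isSplitAt_of_hasGaussDiagram`, required here because the intermediate
diagrams of a chain of Polyak moves need not be realisable (for virtual Gauss diagrams `d² ≠ 0`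
and Khovanov homology is not invariant under the second move, Manturov (2007)).

## References

* M. Khovanov, *A categorification of the Jones polynomial*, Duke Math. J. 101 (2000) 359–426,
  §5.3, Thm. 1. [cite: Khovanov2000, §5.3]
* D. Bar-Natan, *On Khovanov's categorification of the Jones polynomial*, Algebr. Geom. Topol. 2
  (2002) 337–370, §4.3. [cite: BarNatan2002, §4]
* D. Bar-Natan, *Fast Khovanov homology computations*, J. Knot Theory Ramifications 16 (2007)
  243–255, Lemma 4.2. [cite: BarNatan2007, Lemma 4.2]
-/

open Function Finset

noncomputable section

namespace Literature.Topology.FourManifolds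

/-! ## Graded homotopy data (bookkeeping of bidegrees through compositions) -/

namespace KhElim

variable {R : Type} [CommRing R] {S T U : Type} [Fintype S] [Fintype T] [Fintype U]
  [DecidableEq S] [DecidableEq T] [DecidableEq U] {I : S → S → R} {J : T → T → R} {L : U → U → R}

/-- Homotopy data **graded** for degree maps `dS`, `dT`: `F`, `B` of degree `0` and `H` of
degree `(-1, 0)`. [folklore] -/
structure MHtpy.IsGraded (D : MHtpy I J) (dS : S → ℤ × ℤ) (dT : T → ℤ × ℤ) : Prop where
  /-- `F` has degree `0`. -/
  F : Graded dT dS 0 D.F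
  /-- `B` has degree `0`. -/
  B : Graded dS dT 0 D.B
  /-- `H` has degree `(-1, 0)`. -/
  H : Graded dS dS (-1, 0) D.H

/-- Graded homotopy data compose. [folklore] -/
theorem MHtpy.IsGraded.trans {D₁ : MHtpy I J} {D₂ : MHtpy J L} {dS : S → ℤ × ℤ} {dT : T → ℤ × ℤ}
    {dU : U → ℤ × ℤ} (h₁ : D₁.IsGraded dS dT) (h₂ : D₂.IsGraded dT dU) :
    (D₁.trans D₂).IsGraded dS dU where
  F := by
    show Graded dU dS 0 (D₁.F ∘ₗ D₂.F)
    simpa using h₂.F.comp h₁.F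
  B := by
    show Graded dS dU 0 (D₂.B ∘ₗ D₁.B)
    simpa using h₁.B.comp h₂.B
  H := by
    show Graded dS dS (-1, 0) (D₁.H + D₁.F ∘ₗ D₂.H ∘ₗ D₁.B)
    refine Graded.add h₁.H ?_
    simpa using (h₁.B.comp h₂.H).comp h₁.F

/-- `ofEquiv` is graded when the bijection preserves degrees. [folklore] -/
theorem MHtpy.IsGraded.ofEquiv (e : T ≃ S) (I : S → S → R) (J : T → T → R)
    (hIJ : ∀ a b, J a b = I (e a) (e b)) {dS : S → ℤ × ℤ} {dT : T → ℤ × ℤ}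
    (hd : ∀ t, dS (e t) = dT t) : (MHtpy.ofEquiv e I J hIJ).IsGraded dS dT where
  F := Graded.ofEquiv_F e I J hIJ hd
  B := Graded.ofEquiv_B e I J hIJ hd
  H := by rw [MHtpy.ofEquiv_H]; exact Graded.zero _

/-- `rescale` is graded. [folklore] -/
theorem MHtpy.IsGraded.rescale (I : S → S → R) (u : S → R) (hu : ∀ s, u s * u s = 1)
    (dS : S → ℤ × ℤ) : (MHtpy.rescale I u hu).IsGraded dS dS where
  F := Graded.rescale_F I u hu
  B := Graded.rescale_B I u hu
  H := by rw [MHtpy.rescale_H]; exact Graded.zero _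

/-- `congrRight` keeps the grading. [folklore] -/
theorem MHtpy.IsGraded.congrRight {D : MHtpy I J} {J' : T → T → R} (hJ : ∀ a b, J a b = J' a b)
    {dS : S → ℤ × ℤ} {dT : T → ℤ × ℤ} (h : D.IsGraded dS dT) : (D.congrRight hJ).IsGraded dS dT :=
  ⟨h.F, h.B, h.H⟩

/-- Gaussian elimination is graded. [folklore] -/
theorem MHtpy.IsGraded.elim {X C : Type} [Fintype X] [Fintype C] [DecidableEq X] [DecidableEq C]
    {I : X ⊕ (X ⊕ C) → X ⊕ (X ⊕ C) → R} (h2 : ∀ a z, ∑ y, I a y * I y z = 0)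
    (hφ : ∀ x x', I (.inl x) (.inr (.inl x')) = if x = x' then 1 else 0)
    {dM : X ⊕ (X ⊕ C) → ℤ × ℤ} (hI : ∀ a b, I a b ≠ 0 → dM b = dM a + (1, 0))
    (hbe : ∀ x, dM (.inr (.inl x)) = dM (.inl x) + (1, 0)) :
    (KhElim.elim h2 hφ).IsGraded dM (fun r ↦ dM (.inr (.inr r))) where
  F := graded_elim_F hI hbe
  B := graded_elim_B hI hbe
  H := graded_elim_H hbe

end KhElim

namespace GaussDiagram

open KhElim

variable (G : GaussDiagram) (m : Fin (2 * G.n + 1)) (tf : Bool) (ε : ℤˣ)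

/-- The index type of the adapted basis `A ⊕ P ⊕ Q ⊕ U ⊕ C(D)` of the bigon. [folklore] -/
abbrev BigonIdx : Type := G.XA m tf ε ⊕ (G.XA m tf ε ⊕ (G.XA m tf ε ⊕ (G.XA m tf ε ⊕ G.EnhancedState)))

section Ring

variable {R : Type} [CommRing R] (hR tR : R)

/-- The incidence matrix of the bigon in the adapted basis. [folklore] -/
def bigonJ (a b : G.BigonIdx m tf ε) : R :=
  (G.bigon m tf ε).incidence R hR tR (G.embSum m tf ε a) (G.embSum m tf ε b)

/-- **The Koszul signs used to rescale the adapted basis**: on `A` the sign of the edge at `f`,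
on `Q` the sign of the edge at `g`, `1` elsewhere. [folklore] -/
def bigonU : G.BigonIdx m tf ε → R :=
  Sum.elim (fun x ↦ (edgeSign (G.stA m tf ε (G.oldOf m tf ε x.1.state)) (G.fC m tf ε) : R))
    (Sum.elim (fun _ ↦ 1)
      (Sum.elim (fun x ↦ (edgeSign (G.stO m tf ε (G.oldOf m tf ε x.1.state)) (G.gC m tf ε) : R))
        (fun _ ↦ 1)))

/-- The rescaling signs are self-inverse. [folklore] -/
theorem bigonU_mul_self (a : G.BigonIdx m tf ε) : G.bigonU m tf ε (R := R) a * G.bigonU m tf ε a = 1 := by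
  rcases a with x | x | x | r
  · exact Transfer.edgeSign_mul_self _ _
  · exact one_mul 1
  · exact Transfer.edgeSign_mul_self _ _
  · exact one_mul 1

/-- **The rescaled incidence matrix of the bigon in the adapted basis.** [folklore] -/
def bigonJ' (a b : G.BigonIdx m tf ε) : R := G.bigonU m tf ε a * G.bigonJ m tf ε hR tR a b * G.bigonU m tf ε b

variable (hms : ∀ (τ : (G.bigon m tf ε).State) (k : Fin (G.bigon m tf ε).n), τ k = false →
  (G.bigon m tf ε).IsMergeAt τ k ∨ (G.bigon m tf ε).IsSplitAt τ k)

include hms in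
/-- `d² = 0` for the bigon in the adapted basis (from merge-or-split). [folklore] -/
theorem sum_bigonJ_mul (a z : G.BigonIdx m tf ε) :
    ∑ y, G.bigonJ m tf ε hR tR a y * G.bigonJ m tf ε hR tR y z = 0 := by
  unfold bigonJ
  rw [show (∑ y, (G.bigon m tf ε).incidence R hR tR (G.embSum m tf ε a) (G.embSum m tf ε y) *
      (G.bigon m tf ε).incidence R hR tR (G.embSum m tf ε y) (G.embSum m tf ε z)) =
      ∑ y, (G.bigon m tf ε).incidence R hR tR (G.embSum m tf ε a) (G.bigonESEquiv m tf ε y) *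
      (G.bigon m tf ε).incidence R hR tR (G.bigonESEquiv m tf ε y) (G.embSum m tf ε z) from rfl,
    (G.bigonESEquiv m tf ε).sum_comp (fun t ↦ (G.bigon m tf ε).incidence R hR tR (G.embSum m tf ε a) t *
      (G.bigon m tf ε).incidence R hR tR t (G.embSum m tf ε z))]
  exact sum_incidence_mul_incidence_eq_zero hms hR tR _ _

include hms in
/-- `d² = 0` for the rescaled matrix. [folklore] -/
theorem sum_bigonJ'_mul (a z : G.BigonIdx m tf ε) :
    ∑ y, G.bigonJ' m tf ε hR tR a y * G.bigonJ' m tf ε hR tR y z = 0 := by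
  unfold bigonJ'
  have key : ∀ y, G.bigonU m tf ε a * G.bigonJ m tf ε hR tR a y * G.bigonU m tf ε y *
      (G.bigonU m tf ε y * G.bigonJ m tf ε hR tR y z * G.bigonU m tf ε z) =
      G.bigonU m tf ε a * G.bigonU m tf ε z * (G.bigonJ m tf ε hR tR a y * G.bigonJ m tf ε hR tR y z) := by
    intro y
    have := G.bigonU_mul_self m tf ε (R := R) y
    linear_combination (G.bigonU m tf ε a * G.bigonU m tf ε z * G.bigonJ m tf ε hR tR a y *
      G.bigonJ m tf ε hR tR y z) * this
  simp only [key, ← Finset.mul_sum, G.sum_bigonJ_mul m tf ε hR tR hms, mul_zero]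

/-- **The block `A → P` of the rescaled matrix is the identity.** [folklore] -/
theorem bigonJ'_AP (x x' : G.XA m tf ε) :
    G.bigonJ' m tf ε hR tR (.inl x) (.inr (.inl x')) = if x = x' then 1 else 0 := by
  unfold bigonJ' bigonJ bigonU
  simp only [Sum.elim_inl, Sum.elim_inr, embSum_inl, embSum_inr_inl, mul_one]
  rw [incidence_embA_embP]
  split_ifs
  · exact Transfer.edgeSign_mul_self _ _
  · exact mul_zero _

/-- The blocks of the rescaled matrix from `Q`, `U`, `C(D)` into `P` vanish. [folklore] -/
theorem bigonJ'_C1_P (r : G.XA m tf ε ⊕ (G.XA m tf ε ⊕ G.EnhancedState)) (x : G.XA m tf ε) :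
    G.bigonJ' m tf ε hR tR (.inr (.inr r)) (.inr (.inl x)) = 0 := by
  unfold bigonJ' bigonJ
  rcases r with q | q | s
  · simp only [embSum_inr_inr_inl, embSum_inr_inl]
    rw [incidence_eq_zero_of_label_sideM_ne hR tR (embO_state q false) (embO_state x true)
      (by rw [embO_label_sideM, embO_label_sideM]; decide), mul_zero, zero_mul]
  · simp only [embSum_inr_inr_inr_inl, embSum_inr_inl]
    rw [incidence_eq_zero_of_state_true_false hR tR (G.gC m tf ε)
      (by rw [embU_state]; exact G.stU_gC m tf ε _) (by rw [embO_state]; exact G.stO_gC m tf ε _),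
      mul_zero, zero_mul]
  · simp only [embSum_inr_inr_inr_inr, embSum_inr_inl]
    rw [incidence_eq_zero_of_state_true_false hR tR (G.gC m tf ε)
      (by rw [bigonD_state]; exact G.stD_gC m tf ε _) (by rw [embO_state]; exact G.stO_gC m tf ε _),
      mul_zero, zero_mul]

/-- **The matrix after the first cancellation**: the rescaled matrix restricted to
`Q ⊕ U ⊕ C(D)`. [folklore] -/
def bigonJ'' (r r' : G.XA m tf ε ⊕ (G.XA m tf ε ⊕ G.EnhancedState)) : R :=
  G.bigonJ' m tf ε hR tR (.inr (.inr r)) (.inr (.inr r'))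

/-- The reduced matrix of the first cancellation is the restriction (no correction term).
[folklore] -/
theorem redI_bigonJ' (r r' : G.XA m tf ε ⊕ (G.XA m tf ε ⊕ G.EnhancedState)) :
    redI (G.bigonJ' m tf ε hR tR) r r' = G.bigonJ'' m tf ε hR tR r r' := by
  unfold redI bigonJ''
  simp only [bigonJ'_C1_P, zero_mul, Finset.sum_const_zero, sub_zero]

include hms in
/-- `d² = 0` after the first cancellation. [folklore] -/
theorem sum_bigonJ''_mul (a z : G.XA m tf ε ⊕ (G.XA m tf ε ⊕ G.EnhancedState)) :
    ∑ y, G.bigonJ'' m tf ε hR tR a y * G.bigonJ'' m tf ε hR tR y z = 0 := by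
  have := sum_redI_mul_redI (G.sum_bigonJ'_mul m tf ε hR tR hms) (G.bigonJ'_AP m tf ε hR tR) a z
  simpa only [redI_bigonJ'] using this

/-- **The block `Q → U` of the matrix after the first cancellation is the identity.** [folklore] -/
theorem bigonJ''_QU (x x' : G.XA m tf ε) :
    G.bigonJ'' m tf ε hR tR (.inl x) (.inr (.inl x')) = if x = x' then 1 else 0 := by
  unfold bigonJ'' bigonJ' bigonJ bigonU
  simp only [Sum.elim_inl, Sum.elim_inr, embSum_inr_inr_inl, embSum_inr_inr_inr_inl, mul_one]
  rw [incidence_embQ_embU]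
  split_ifs
  · exact Transfer.edgeSign_mul_self _ _
  · exact mul_zero _

/-- The block from `Q` into `C(D)` vanishes. [folklore] -/
theorem bigonJ''_Q_D (x : G.XA m tf ε) (s : G.EnhancedState) :
    G.bigonJ'' m tf ε hR tR (.inl x) (.inr (.inr s)) = 0 := by
  unfold bigonJ'' bigonJ' bigonJ
  simp only [embSum_inr_inr_inl, embSum_inr_inr_inr_inr]
  rw [incidence_eq_zero_of_state_true_false hR tR (G.fC m tf ε)
    (by rw [embO_state]; exact G.stO_fC m tf ε _) (by rw [bigonD_state]; exact G.stD_fC m tf ε _),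
    mul_zero, zero_mul]

/-- **The matrix after both cancellations is the incidence matrix of `G`.** [folklore] -/
theorem redI_bigonJ'' (s s' : G.EnhancedState) :
    redI (G.bigonJ'' m tf ε hR tR) s s' = G.incidence R hR tR s s' := by
  unfold redI
  simp only [bigonJ''_Q_D, mul_zero, Finset.sum_const_zero, sub_zero]
  unfold bigonJ'' bigonJ' bigonJ bigonU
  simp only [Sum.elim_inr, embSum_inr_inr_inr_inr, one_mul, mul_one]
  exact incidence_bigonD m tf ε hR tR s s'

/-- **The complex of the bigon retracts by deformation onto the complex of `G`** (total
homotopy data between the incidence matrices): relabel to the adapted basis, rescale by the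
Koszul signs, cancel the identity block `A → P`, then the identity block `Q → U`
(`KhElim.elim`, Bar-Natan (2007), Lemma 4.2), and identify what is left with `C(D)`
(`redI_bigonJ''`). Khovanov (2000), §5.3; Bar-Natan (2002), §4.3. [cite: Khovanov2000, §5.3] -/
def bigonMHtpy : MHtpy ((G.bigon m tf ε).incidence R hR tR) (G.incidence R hR tR) :=
  (MHtpy.ofEquiv (G.bigonESEquiv m tf ε) ((G.bigon m tf ε).incidence R hR tR) (G.bigonJ m tf ε hR tR)
      (fun _ _ ↦ rfl)).trans
    ((MHtpy.rescale (G.bigonJ m tf ε hR tR) (G.bigonU m tf ε) (G.bigonU_mul_self m tf ε)).trans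
      (((KhElim.elim (G.sum_bigonJ'_mul m tf ε hR tR hms) (G.bigonJ'_AP m tf ε hR tR)).congrRight
          (G.redI_bigonJ' m tf ε hR tR)).trans
        ((KhElim.elim (G.sum_bigonJ''_mul m tf ε hR tR hms) (G.bigonJ''_QU m tf ε hR tR)).congrRight
          (G.redI_bigonJ'' m tf ε hR tR))))

/-- **Total homotopy data between the Khovanov cochains of `G` and of the bigon.**
[cite: Khovanov2000, §5.3] -/
def bigonHtpyData : HtpyData R G (G.bigon m tf ε) hR tR := (G.bigonMHtpy m tf ε hR tR hms).toHtpyData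

/-! ### Degrees -/

/-- A degree map on the enhanced states of the bigon is **admissible** if nonzero incidence
numbers raise it by `(1, 0)`, both over `R` and over `ℤ` at `h = t = 0`. [folklore] -/
structure AdmissibleDeg (d : (G.bigon m tf ε).EnhancedState → ℤ × ℤ) : Prop where
  /-- Over `R`. -/
  ringDeg : ∀ a b, (G.bigon m tf ε).incidence R hR tR a b ≠ 0 → d b = d a + (1, 0)
  /-- Over `ℤ` at `h = t = 0`. -/
  intDeg : ∀ a b, (G.bigon m tf ε).incidence ℤ 0 0 a b ≠ 0 → d b = d a + (1, 0)

variable {hR tR}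

/-- **The homotopy data of the bigon are graded** for every admissible degree map (source
degrees read through `bigonD`). [folklore] -/
theorem isGraded_bigonMHtpy {d : (G.bigon m tf ε).EnhancedState → ℤ × ℤ}
    (hd : G.AdmissibleDeg m tf ε hR tR d) :
    (G.bigonMHtpy m tf ε hR tR hms).IsGraded d (fun s ↦ d (bigonD m tf ε s)) := by
  unfold bigonMHtpy
  refine MHtpy.IsGraded.trans (MHtpy.IsGraded.ofEquiv _ _ _ _ (dT := fun a ↦ d (G.embSum m tf ε a))
    (fun _ ↦ rfl)) ?_
  refine MHtpy.IsGraded.trans (MHtpy.IsGraded.rescale _ _ _ _) ?_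
  have hI : ∀ a b, G.bigonJ' m tf ε hR tR a b ≠ 0 →
      d (G.embSum m tf ε b) = d (G.embSum m tf ε a) + (1, 0) := by
    intro a b hab
    apply hd.ringDeg
    intro h0
    apply hab
    unfold bigonJ' bigonJ
    rw [h0, mul_zero, zero_mul]
  refine MHtpy.IsGraded.trans (MHtpy.IsGraded.congrRight _ (MHtpy.IsGraded.elim _ _ hI ?_)) ?_
  · intro x
    simp only [embSum_inr_inl, embSum_inl]
    exact hd.intDeg _ _ (incidence_embA_embP_self_ne_zero x)
  · refine MHtpy.IsGraded.congrRight _ (MHtpy.IsGraded.elim _ _ (fun a b hab ↦ hI _ _ hab) ?_)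
    intro x
    simp only [embSum_inr_inr_inl, embSum_inr_inr_inr_inl]
    exact hd.intDeg _ _ (incidence_embQ_embU_self_ne_zero x)

variable (hR tR)

/-- The homological degree (alone) is an admissible degree map. [folklore] -/
theorem admissibleDeg_homDegree :
    G.AdmissibleDeg m tf ε hR tR (fun s ↦ ((homDegree s : ℤ), (0 : ℤ))) where
  ringDeg a b h0 := by
    rw [Prod.mk_add_mk, add_zero, homDegree_eq_of_incidence_ne_zero h0]
  intDeg a b h0 := by
    rw [Prod.mk_add_mk, add_zero, homDegree_eq_of_incidence_ne_zero h0]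

/-- The bidegree is an admissible degree map at `h = t = 0` over `ℤ`. [folklore] -/
theorem admissibleDeg_bideg :
    G.AdmissibleDeg m tf ε (0 : ℤ) 0 (fun s ↦ (homDegree s, qDegree s)) where
  ringDeg a b h0 := by
    rw [Prod.mk_add_mk, add_zero, homDegree_eq_of_incidence_ne_zero h0,
      qDegree_eq_of_incidence_ne_zero_holds h0]
  intDeg a b h0 := by
    rw [Prod.mk_add_mk, add_zero, homDegree_eq_of_incidence_ne_zero h0,
      qDegree_eq_of_incidence_ne_zero_holds h0]

/-! ### The isomorphisms -/

include hms in
/-- **Invariance of the homology over the universal Frobenius system under the second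
Reidemeister move (bigon in normal position)**, for a bigon all of whose cube edges are merges
or splits: `H^i(G; h, t) ≅ H^i(G.bigon m tf ε; h, t)` for every `(R, h, t)` and `i`.
Khovanov (2000), §5.3 (with Khovanov (2006) for general `(h, t)`); Bar-Natan (2002), §4.3.
[cite: Khovanov2000, §5.3] -/
theorem nonempty_iso_frobeniusHomology_bigon (i : ℤ) :
    Nonempty (G.frobeniusHomology R hR tR i ≅ (G.bigon m tf ε).frobeniusHomology R hR tR i) := by
  have hg := G.isGraded_bigonMHtpy m tf ε hms (G.admissibleDeg_homDegree m tf ε hR tR)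
  refine (G.bigonHtpyData m tf ε hR tR hms).nonempty_iso_frobeniusHomology ?_ ?_ ?_ i
  · intro k w hw s hs
    refine hg.F.apply_eq_zero_fst (i := k) (fun t ht ↦ hw t ?_) ?_
    · simpa [homDegree_bigonD] using ht
    · simpa using hs
  · intro k v hv s hs
    refine hg.B.apply_eq_zero_fst (i := k) (fun t ht ↦ hv t (by simpa using ht)) ?_
    simpa [homDegree_bigonD] using hs
  · intro k v hv s hs
    refine hg.H.apply_eq_zero_fst (i := k) (fun t ht ↦ hv t (by simpa using ht)) ?_
    simp only [ne_eq]
    intro h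
    exact hs (by omega)

include hms in
/-- **Invariance of Khovanov homology under the second Reidemeister move (bigon in normal
position)**, for a bigon all of whose cube edges are merges or splits:
`Kh^{i,j}(G) ≅ Kh^{i,j}(G.bigon m tf ε)`. Khovanov (2000), §5.3, Thm. 1; Bar-Natan (2002),
§4.3. [cite: Khovanov2000, §5.3] -/
theorem nonempty_iso_khovanovHomology_bigon (i j : ℤ) :
    Nonempty (G.khovanovHomology i j ≅ (G.bigon m tf ε).khovanovHomology i j) := by
  have hg := G.isGraded_bigonMHtpy m tf ε (hR := (0 : ℤ)) (tR := 0) hms (G.admissibleDeg_bideg m tf ε)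
  refine (G.bigonHtpyData m tf ε (0 : ℤ) 0 hms).nonempty_iso_khovanovHomology ?_ ?_ ?_ i j
  · intro k l w hw s hs
    refine hg.F.apply_eq_zero (g := (k, l)) (fun t ht ↦ hw t ?_) ?_
    · simpa [homDegree_bigonD, qDegree_bigonD, Prod.ext_iff] using ht
    · simpa [Prod.ext_iff] using hs
  · intro k l v hv s hs
    refine hg.B.apply_eq_zero (g := (k, l)) (fun t ht ↦ hv t (by simpa [Prod.ext_iff] using ht)) ?_
    simpa [homDegree_bigonD, qDegree_bigonD, Prod.ext_iff] using hs
  · intro k l v hv s hs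
    refine hg.H.apply_eq_zero (g := (k, l)) (fun t ht ↦ hv t (by simpa [Prod.ext_iff] using ht)) ?_
    simp only [ne_eq, Prod.mk_add_mk, add_zero, Prod.ext_iff, not_and]
    intro h
    exact (hs ⟨by omega, ·⟩)

end Ring

/-- **Invariance of Khovanov homology under the second Reidemeister move, for a bigon realised
by a knot**: `Kh^{i,j}(G) ≅ Kh^{i,j}(G.bigon m tf ε)`. The merge-or-split hypothesis is the
proved fact `isMergeAt_or_isSplitAt_of_hasGaussDiagram`. Khovanov (2000), §5.3, Thm. 1.
[cite: Khovanov2000, Thm. 1] -/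
theorem nonempty_iso_khovanovHomology_bigon_of_hasGaussDiagram
    (hK : ∃ K : Knot, K.HasGaussDiagram (G.bigon m tf ε)) (i j : ℤ) :
    Nonempty (G.khovanovHomology i j ≅ (G.bigon m tf ε).khovanovHomology i j) :=
  G.nonempty_iso_khovanovHomology_bigon m tf ε
    (fun _ _ hτ ↦ isMergeAt_or_isSplitAt_of_hasGaussDiagram_holds hK hτ) i j

/-- **Invariance of the homology over the universal Frobenius system under the second
Reidemeister move, for a bigon realised by a knot.** [cite: Khovanov2000, Thm. 1] -/
theorem nonempty_iso_frobeniusHomology_bigon_of_hasGaussDiagram {R : Type} [CommRing R] (hR tR : R)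
    (hK : ∃ K : Knot, K.HasGaussDiagram (G.bigon m tf ε)) (i : ℤ) :
    Nonempty (G.frobeniusHomology R hR tR i ≅ (G.bigon m tf ε).frobeniusHomology R hR tR i) :=
  G.nonempty_iso_frobeniusHomology_bigon m tf ε hR tR
    (fun _ _ hτ ↦ isMergeAt_or_isSplitAt_of_hasGaussDiagram_holds hK hτ) i

end GaussDiagram

end Literature.Topology.FourManifolds
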